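import Summits.Parity.GeneralizedHardyLittlewood.Theorems.PrimeLevelFamEdgeMomentsBeyondDiagonalDiagRemThreeThreeKernels
import Summits.Parity.GeneralizedHardyLittlewood.Theorems.PrimeLevelFamEdgeMomentsBeyondDiagonalDiagRemFourFourBose
import HarnessLib

/-!
# Route `PrimeLevelFamEdge`, crux K_A `MomentsBeyondDiagonal` (stmt-Parity-20007), line «petersson_layers» v4, stub `stub_diag`:
# **nine remainder kernels of ORDER `(4,4)` — `r_ab` with `a + b ∈ {3, 4}` — under ONE constant: two-sequence estimates with
# the order-(4,4) envelope `9C₀(1+|log 2αY²|)¹⁰` AND the pointwise bounds `|r_ab(y)| ≤ C₀√y` (`y ≤ 1`), `≤ C₀(1+log y)⁵` (`y ≥ 1`)**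
# (brick B4b of the remainder estimate (R₄₄); the order-`(4,4)` twin of `…DiagRemThreeThreeKernelsBoth.twoSeq_six₃₃`)

At order `(4,4)` the remainder weight (`rem₄₄` of `…DiagDecorOrderFourFourSplit.selbergOrderFourFour_split`) carries all twenty-five
continued Bose remainders `r_ab`, `a, b ≤ 4`, and the BOTH-SIDED decorated monomials (`m_r(k₁)m_s(k₂)`, `r, s ≥ 2`, `r + s ≤ 8 − a − b`)
occur exactly for `a + b ≤ 4`: those fifteen kernels need, besides the two-sequence Abel estimate, the small- and large-argument
pointwise bounds with the SAME `E_ab`. The six with `a + b ≤ 2` have them in `…KernelsBoth.twoSeq_six₃₃` /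
`…KernelsAll.twoSeq_sixteen₃₃`; this file supplies the remaining nine, `(a,b) ∈ {(0,3),(1,2),(2,1),(3,0),(0,4),(1,3),(2,2),(3,1),(4,0)}`,
UNIFORMLY from the generic `…DiagRemThreeThreeKernels.abs_bose_rem_twoSeq_small_tail` in the `Π`-form printed by the split
(moments `μ₂, μ₄ = ∫₀¹logᵐv·v/(1+v²)²` explicit, `μ₀ = 1/4`, odd moments cancel), with the common envelope exponent `10`
(`…DiagRemFourFourBose.weaken_second_term10`, `a + b + 1 ≤ 9`) and the common large-argument exponent `5` (`a + b + 1 ≤ 5`):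

* `twoSeq_nine₄₄` — **nine two-sequence estimates (disjunctive form, one `C₀`) ∧ the pointwise bounds of the same nine kernels.**

Def-free; theorems only. Helper `--supports stmt-Parity-20007`; closes nothing (the bundle of all twenty-five kernels, bricks B3–B5
of (R₄₄) and the polynomial side of order `(4,4)` remain); K_A, K_B and the Parity summit are NOT proved; nothing about Landau–Siegel zeros.

## References
* E. Kowalski, P. Michel, J. VanderKam, J. reine angew. Math. 526 (2000), (22)–(28) pp. 12–15 and Prop. 5.1 p. 18.
  [cite: KowalskiMichelVanderKam2000, (23)–(28) and Prop. 5.1 — derivation (order-(4,4) remainder, inner sums)]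
-/

noncomputable section

open Real MeasureTheory Finset

namespace Summit.Parity.GeneralizedHardyLittlewood.Theorems.MomentsBeyondDiagonal.DiagCorner

open Summit.Parity.GeneralizedHardyLittlewood.Theorems.BeyondDiagonalBeatsQuarter.Corner
open Summit.Parity.GeneralizedHardyLittlewood.Theorems.MomentsBeyondDiagonal.DiagLines

set_option maxHeartbeats 3200000 in
-- nine kernels, large statement; one generated simp set per kernel
/-- **Nine remainder kernels of order `(4,4)` (`a + b ∈ {3,4}`) under one constant: two-sequence estimates (envelope exponent `10`)
AND the pointwise bounds `|r_ab(y)| ≤ C₀√y` (`y ≤ 1`), `≤ C₀(1+log y)⁵` (`y ≥ 1`) with the same `E_ab`** (module docstring).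
[cite: KowalskiMichelVanderKam2000, (23)–(28) and Prop. 5.1 — derivation (order-(4,4) remainder, inner sums)] -/
theorem twoSeq_nine₄₄ : ∃ E₀₃ E₁₂ E₂₁ E₃₀ E₀₄ E₁₃ E₂₂ E₃₁ E₄₀ C₀ : ℝ, 0 ≤ C₀ ∧
    (∀ R : ℝ → ℝ,
      (R = (fun y : ℝ ↦ (∫ u₁ in Set.Ioi (0 : ℝ), ∫ u₂ in Set.Ioi (y / u₁), Real.exp (-(u₁ + u₂)) / (1 - Real.exp (-(u₁ + u₂))) ^ 2 * Real.log u₂ ^ 3) -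
            (-(Real.log (1 / y) ^ 4) / 64 - 3 * (∫ v in Set.Ioc (0 : ℝ) 1, Real.log v ^ 2 * (v / (1 + v ^ 2) ^ 2)) / 2 * Real.log (1 / y) ^ 2 + E₀₃)) ∨
       R = (fun y : ℝ ↦ (∫ u₁ in Set.Ioi (0 : ℝ), Real.log u₁ * ∫ u₂ in Set.Ioi (y / u₁), Real.exp (-(u₁ + u₂)) / (1 - Real.exp (-(u₁ + u₂))) ^ 2 * Real.log u₂ ^ 2) -
            (-(Real.log (1 / y) ^ 4) / 64 + (∫ v in Set.Ioc (0 : ℝ) 1, Real.log v ^ 2 * (v / (1 + v ^ 2) ^ 2)) / 2 * Real.log (1 / y) ^ 2 + E₁₂)) ∨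
       R = (fun y : ℝ ↦ (∫ u₁ in Set.Ioi (0 : ℝ), Real.log u₁ ^ 2 * ∫ u₂ in Set.Ioi (y / u₁), Real.exp (-(u₁ + u₂)) / (1 - Real.exp (-(u₁ + u₂))) ^ 2 * Real.log u₂) -
            (-(Real.log (1 / y) ^ 4) / 64 + (∫ v in Set.Ioc (0 : ℝ) 1, Real.log v ^ 2 * (v / (1 + v ^ 2) ^ 2)) / 2 * Real.log (1 / y) ^ 2 + E₂₁)) ∨
       R = (fun y : ℝ ↦ (∫ u₁ in Set.Ioi (0 : ℝ), Real.log u₁ ^ 3 * ∫ u₂ in Set.Ioi (y / u₁), Real.exp (-(u₁ + u₂)) / (1 - Real.exp (-(u₁ + u₂))) ^ 2) -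
            (-(Real.log (1 / y) ^ 4) / 64 - 3 * (∫ v in Set.Ioc (0 : ℝ) 1, Real.log v ^ 2 * (v / (1 + v ^ 2) ^ 2)) / 2 * Real.log (1 / y) ^ 2 + E₃₀)) ∨
       R = (fun y : ℝ ↦ (∫ u₁ in Set.Ioi (0 : ℝ), ∫ u₂ in Set.Ioi (y / u₁), Real.exp (-(u₁ + u₂)) / (1 - Real.exp (-(u₁ + u₂))) ^ 2 * Real.log u₂ ^ 4) -
            (Real.log (1 / y) ^ 5 / 160 + (∫ v in Set.Ioc (0 : ℝ) 1, Real.log v ^ 2 * (v / (1 + v ^ 2) ^ 2)) * Real.log (1 / y) ^ 3 + 2 * (∫ v in Set.Ioc (0 : ℝ) 1, Real.log v ^ 4 * (v / (1 + v ^ 2) ^ 2)) * Real.log (1 / y) + E₀₄)) ∨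
       R = (fun y : ℝ ↦ (∫ u₁ in Set.Ioi (0 : ℝ), Real.log u₁ * ∫ u₂ in Set.Ioi (y / u₁), Real.exp (-(u₁ + u₂)) / (1 - Real.exp (-(u₁ + u₂))) ^ 2 * Real.log u₂ ^ 3) -
            (Real.log (1 / y) ^ 5 / 160 - 2 * (∫ v in Set.Ioc (0 : ℝ) 1, Real.log v ^ 4 * (v / (1 + v ^ 2) ^ 2)) * Real.log (1 / y) + E₁₃)) ∨
       R = (fun y : ℝ ↦ (∫ u₁ in Set.Ioi (0 : ℝ), Real.log u₁ ^ 2 * ∫ u₂ in Set.Ioi (y / u₁), Real.exp (-(u₁ + u₂)) / (1 - Real.exp (-(u₁ + u₂))) ^ 2 * Real.log u₂ ^ 2) -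
            (Real.log (1 / y) ^ 5 / 160 - (∫ v in Set.Ioc (0 : ℝ) 1, Real.log v ^ 2 * (v / (1 + v ^ 2) ^ 2)) / 3 * Real.log (1 / y) ^ 3 + 2 * (∫ v in Set.Ioc (0 : ℝ) 1, Real.log v ^ 4 * (v / (1 + v ^ 2) ^ 2)) * Real.log (1 / y) + E₂₂)) ∨
       R = (fun y : ℝ ↦ (∫ u₁ in Set.Ioi (0 : ℝ), Real.log u₁ ^ 3 * ∫ u₂ in Set.Ioi (y / u₁), Real.exp (-(u₁ + u₂)) / (1 - Real.exp (-(u₁ + u₂))) ^ 2 * Real.log u₂) -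
            (Real.log (1 / y) ^ 5 / 160 - 2 * (∫ v in Set.Ioc (0 : ℝ) 1, Real.log v ^ 4 * (v / (1 + v ^ 2) ^ 2)) * Real.log (1 / y) + E₃₁)) ∨
       R = (fun y : ℝ ↦ (∫ u₁ in Set.Ioi (0 : ℝ), Real.log u₁ ^ 4 * ∫ u₂ in Set.Ioi (y / u₁), Real.exp (-(u₁ + u₂)) / (1 - Real.exp (-(u₁ + u₂))) ^ 2) -
            (Real.log (1 / y) ^ 5 / 160 + (∫ v in Set.Ioc (0 : ℝ) 1, Real.log v ^ 2 * (v / (1 + v ^ 2) ^ 2)) * Real.log (1 / y) ^ 3 + 2 * (∫ v in Set.Ioc (0 : ℝ) 1, Real.log v ^ 4 * (v / (1 + v ^ 2) ^ 2)) * Real.log (1 / y) + E₄₀))) →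
      ∀ (a₁ a₂ : ℕ → ℝ) (Y α B η : ℝ) (K₁ i j : ℕ), 1 ≤ Y → 0 < α → 1 ≤ i → 1 ≤ j →
        (∀ e : ℕ, e ≤ ⌊Y⌋₊ → |∑ k ∈ Icc 1 e, a₂ k| ≤ B) → (∀ e : ℕ, K₁ ≤ e → |∑ k ∈ Icc 1 e, a₁ k| ≤ η) →
        2 * α * K₁ * Y ≤ 1 →
      |∑ k₁ ∈ Icc 1 ⌊Y⌋₊, ∑ k₂ ∈ Icc 1 ⌊Y⌋₊,
          a₁ k₁ * a₂ k₂ * ellp Y k₁ ^ i * ellp Y k₂ ^ j * R (α * k₁ * k₂)| ≤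
        (∑ k ∈ Icc 1 ⌊Y⌋₊, |a₁ k| * ellp Y k ^ i) * (B * (Real.log Y ^ j * (3 * C₀ * Real.sqrt (2 * α * K₁ * Y)))) +
          (∑ k ∈ Icc 1 ⌊Y⌋₊, |a₂ k| * ellp Y k ^ j) *
            ((2 * η) * (Real.log Y ^ i * (9 * C₀ * (1 + |Real.log (2 * α * Y ^ 2)|) ^ 10)))) ∧
    (∀ R : ℝ → ℝ,
      (R = (fun y : ℝ ↦ (∫ u₁ in Set.Ioi (0 : ℝ), ∫ u₂ in Set.Ioi (y / u₁), Real.exp (-(u₁ + u₂)) / (1 - Real.exp (-(u₁ + u₂))) ^ 2 * Real.log u₂ ^ 3) -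
            (-(Real.log (1 / y) ^ 4) / 64 - 3 * (∫ v in Set.Ioc (0 : ℝ) 1, Real.log v ^ 2 * (v / (1 + v ^ 2) ^ 2)) / 2 * Real.log (1 / y) ^ 2 + E₀₃)) ∨
       R = (fun y : ℝ ↦ (∫ u₁ in Set.Ioi (0 : ℝ), Real.log u₁ * ∫ u₂ in Set.Ioi (y / u₁), Real.exp (-(u₁ + u₂)) / (1 - Real.exp (-(u₁ + u₂))) ^ 2 * Real.log u₂ ^ 2) -
            (-(Real.log (1 / y) ^ 4) / 64 + (∫ v in Set.Ioc (0 : ℝ) 1, Real.log v ^ 2 * (v / (1 + v ^ 2) ^ 2)) / 2 * Real.log (1 / y) ^ 2 + E₁₂)) ∨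
       R = (fun y : ℝ ↦ (∫ u₁ in Set.Ioi (0 : ℝ), Real.log u₁ ^ 2 * ∫ u₂ in Set.Ioi (y / u₁), Real.exp (-(u₁ + u₂)) / (1 - Real.exp (-(u₁ + u₂))) ^ 2 * Real.log u₂) -
            (-(Real.log (1 / y) ^ 4) / 64 + (∫ v in Set.Ioc (0 : ℝ) 1, Real.log v ^ 2 * (v / (1 + v ^ 2) ^ 2)) / 2 * Real.log (1 / y) ^ 2 + E₂₁)) ∨
       R = (fun y : ℝ ↦ (∫ u₁ in Set.Ioi (0 : ℝ), Real.log u₁ ^ 3 * ∫ u₂ in Set.Ioi (y / u₁), Real.exp (-(u₁ + u₂)) / (1 - Real.exp (-(u₁ + u₂))) ^ 2) -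
            (-(Real.log (1 / y) ^ 4) / 64 - 3 * (∫ v in Set.Ioc (0 : ℝ) 1, Real.log v ^ 2 * (v / (1 + v ^ 2) ^ 2)) / 2 * Real.log (1 / y) ^ 2 + E₃₀)) ∨
       R = (fun y : ℝ ↦ (∫ u₁ in Set.Ioi (0 : ℝ), ∫ u₂ in Set.Ioi (y / u₁), Real.exp (-(u₁ + u₂)) / (1 - Real.exp (-(u₁ + u₂))) ^ 2 * Real.log u₂ ^ 4) -
            (Real.log (1 / y) ^ 5 / 160 + (∫ v in Set.Ioc (0 : ℝ) 1, Real.log v ^ 2 * (v / (1 + v ^ 2) ^ 2)) * Real.log (1 / y) ^ 3 + 2 * (∫ v in Set.Ioc (0 : ℝ) 1, Real.log v ^ 4 * (v / (1 + v ^ 2) ^ 2)) * Real.log (1 / y) + E₀₄)) ∨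
       R = (fun y : ℝ ↦ (∫ u₁ in Set.Ioi (0 : ℝ), Real.log u₁ * ∫ u₂ in Set.Ioi (y / u₁), Real.exp (-(u₁ + u₂)) / (1 - Real.exp (-(u₁ + u₂))) ^ 2 * Real.log u₂ ^ 3) -
            (Real.log (1 / y) ^ 5 / 160 - 2 * (∫ v in Set.Ioc (0 : ℝ) 1, Real.log v ^ 4 * (v / (1 + v ^ 2) ^ 2)) * Real.log (1 / y) + E₁₃)) ∨
       R = (fun y : ℝ ↦ (∫ u₁ in Set.Ioi (0 : ℝ), Real.log u₁ ^ 2 * ∫ u₂ in Set.Ioi (y / u₁), Real.exp (-(u₁ + u₂)) / (1 - Real.exp (-(u₁ + u₂))) ^ 2 * Real.log u₂ ^ 2) -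
            (Real.log (1 / y) ^ 5 / 160 - (∫ v in Set.Ioc (0 : ℝ) 1, Real.log v ^ 2 * (v / (1 + v ^ 2) ^ 2)) / 3 * Real.log (1 / y) ^ 3 + 2 * (∫ v in Set.Ioc (0 : ℝ) 1, Real.log v ^ 4 * (v / (1 + v ^ 2) ^ 2)) * Real.log (1 / y) + E₂₂)) ∨
       R = (fun y : ℝ ↦ (∫ u₁ in Set.Ioi (0 : ℝ), Real.log u₁ ^ 3 * ∫ u₂ in Set.Ioi (y / u₁), Real.exp (-(u₁ + u₂)) / (1 - Real.exp (-(u₁ + u₂))) ^ 2 * Real.log u₂) -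
            (Real.log (1 / y) ^ 5 / 160 - 2 * (∫ v in Set.Ioc (0 : ℝ) 1, Real.log v ^ 4 * (v / (1 + v ^ 2) ^ 2)) * Real.log (1 / y) + E₃₁)) ∨
       R = (fun y : ℝ ↦ (∫ u₁ in Set.Ioi (0 : ℝ), Real.log u₁ ^ 4 * ∫ u₂ in Set.Ioi (y / u₁), Real.exp (-(u₁ + u₂)) / (1 - Real.exp (-(u₁ + u₂))) ^ 2) -
            (Real.log (1 / y) ^ 5 / 160 + (∫ v in Set.Ioc (0 : ℝ) 1, Real.log v ^ 2 * (v / (1 + v ^ 2) ^ 2)) * Real.log (1 / y) ^ 3 + 2 * (∫ v in Set.Ioc (0 : ℝ) 1, Real.log v ^ 4 * (v / (1 + v ^ 2) ^ 2)) * Real.log (1 / y) + E₄₀))) →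
      (∀ y : ℝ, 0 < y → y ≤ 1 → |R y| ≤ C₀ * Real.sqrt y) ∧ (∀ y : ℝ, 1 ≤ y → |R y| ≤ C₀ * (1 + Real.log y) ^ 5)) := by
  obtain ⟨C₀₃, hC₀₃, h₀₃, hs₀₃, ht₀₃⟩ := abs_bose_rem_twoSeq_small_tail 0 3
  obtain ⟨C₁₂, hC₁₂, h₁₂, hs₁₂, ht₁₂⟩ := abs_bose_rem_twoSeq_small_tail 1 2
  obtain ⟨C₂₁, hC₂₁, h₂₁, hs₂₁, ht₂₁⟩ := abs_bose_rem_twoSeq_small_tail 2 1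
  obtain ⟨C₃₀, hC₃₀, h₃₀, hs₃₀, ht₃₀⟩ := abs_bose_rem_twoSeq_small_tail 3 0
  obtain ⟨C₀₄, hC₀₄, h₀₄, hs₀₄, ht₀₄⟩ := abs_bose_rem_twoSeq_small_tail 0 4
  obtain ⟨C₁₃, hC₁₃, h₁₃, hs₁₃, ht₁₃⟩ := abs_bose_rem_twoSeq_small_tail 1 3
  obtain ⟨C₂₂, hC₂₂, h₂₂, hs₂₂, ht₂₂⟩ := abs_bose_rem_twoSeq_small_tail 2 2
  obtain ⟨C₃₁, hC₃₁, h₃₁, hs₃₁, ht₃₁⟩ := abs_bose_rem_twoSeq_small_tail 3 1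
  obtain ⟨C₄₀, hC₄₀, h₄₀, hs₄₀, ht₄₀⟩ := abs_bose_rem_twoSeq_small_tail 4 0
  set C₀ : ℝ := C₀₃ + C₁₂ + C₂₁ + C₃₀ + C₀₄ + C₁₃ + C₂₂ + C₃₁ + C₄₀ with hC₀
  have hC₀0 : 0 ≤ C₀ := by rw [hC₀]; positivity
  have e₀₃ : C₀₃ ≤ C₀ := by rw [hC₀]; linarith [hC₀₃, hC₁₂, hC₂₁, hC₃₀, hC₀₄, hC₁₃, hC₂₂, hC₃₁, hC₄₀]
  have e₁₂ : C₁₂ ≤ C₀ := by rw [hC₀]; linarith [hC₀₃, hC₁₂, hC₂₁, hC₃₀, hC₀₄, hC₁₃, hC₂₂, hC₃₁, hC₄₀]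
  have e₂₁ : C₂₁ ≤ C₀ := by rw [hC₀]; linarith [hC₀₃, hC₁₂, hC₂₁, hC₃₀, hC₀₄, hC₁₃, hC₂₂, hC₃₁, hC₄₀]
  have e₃₀ : C₃₀ ≤ C₀ := by rw [hC₀]; linarith [hC₀₃, hC₁₂, hC₂₁, hC₃₀, hC₀₄, hC₁₃, hC₂₂, hC₃₁, hC₄₀]
  have e₀₄ : C₀₄ ≤ C₀ := by rw [hC₀]; linarith [hC₀₃, hC₁₂, hC₂₁, hC₃₀, hC₀₄, hC₁₃, hC₂₂, hC₃₁, hC₄₀]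
  have e₁₃ : C₁₃ ≤ C₀ := by rw [hC₀]; linarith [hC₀₃, hC₁₂, hC₂₁, hC₃₀, hC₀₄, hC₁₃, hC₂₂, hC₃₁, hC₄₀]
  have e₂₂ : C₂₂ ≤ C₀ := by rw [hC₀]; linarith [hC₀₃, hC₁₂, hC₂₁, hC₃₀, hC₀₄, hC₁₃, hC₂₂, hC₃₁, hC₄₀]
  have e₃₁ : C₃₁ ≤ C₀ := by rw [hC₀]; linarith [hC₀₃, hC₁₂, hC₂₁, hC₃₀, hC₀₄, hC₁₃, hC₂₂, hC₃₁, hC₄₀]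
  have e₄₀ : C₄₀ ≤ C₀ := by rw [hC₀]; linarith [hC₀₃, hC₁₂, hC₂₁, hC₃₀, hC₀₄, hC₁₃, hC₂₂, hC₃₁, hC₄₀]
  have hc32 : Nat.choose 3 2 = 3 := by decide
  have hc42 : Nat.choose 4 2 = 6 := by decide
  have hc43 : Nat.choose 4 3 = 4 := by decide
  refine ⟨((∫ u₁ in Set.Ioi (0 : ℝ), Real.log u₁ ^ 0 * ∫ u₂ in Set.Ioi (1 / u₁),
        Real.exp (-(u₁ + u₂)) / (1 - Real.exp (-(u₁ + u₂))) ^ 2 * Real.log u₂ ^ 3) +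
      (∫ η in Set.Ioc (0 : ℝ) 1, (η * (∫ u in Set.Ioi (0 : ℝ), Real.log u ^ 0 * Real.log (η / u) ^ 3 *
            (Real.exp (-(u + η / u)) / (1 - Real.exp (-(u + η / u))) ^ 2) / u) -
          ∫ v in Set.Ioc (0 : ℝ) 1, ((-(Real.log (1 / η) / 2) + Real.log v) ^ 0 * (-(Real.log (1 / η) / 2) - Real.log v) ^ 3 +
              (-(Real.log (1 / η) / 2) - Real.log v) ^ 0 * (-(Real.log (1 / η) / 2) + Real.log v) ^ 3) *
            (v / (1 + v ^ 2) ^ 2)) / η)),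
    ((∫ u₁ in Set.Ioi (0 : ℝ), Real.log u₁ ^ 1 * ∫ u₂ in Set.Ioi (1 / u₁),
        Real.exp (-(u₁ + u₂)) / (1 - Real.exp (-(u₁ + u₂))) ^ 2 * Real.log u₂ ^ 2) +
      (∫ η in Set.Ioc (0 : ℝ) 1, (η * (∫ u in Set.Ioi (0 : ℝ), Real.log u ^ 1 * Real.log (η / u) ^ 2 *
            (Real.exp (-(u + η / u)) / (1 - Real.exp (-(u + η / u))) ^ 2) / u) -
          ∫ v in Set.Ioc (0 : ℝ) 1, ((-(Real.log (1 / η) / 2) + Real.log v) ^ 1 * (-(Real.log (1 / η) / 2) - Real.log v) ^ 2 +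
              (-(Real.log (1 / η) / 2) - Real.log v) ^ 1 * (-(Real.log (1 / η) / 2) + Real.log v) ^ 2) *
            (v / (1 + v ^ 2) ^ 2)) / η)),
    ((∫ u₁ in Set.Ioi (0 : ℝ), Real.log u₁ ^ 2 * ∫ u₂ in Set.Ioi (1 / u₁),
        Real.exp (-(u₁ + u₂)) / (1 - Real.exp (-(u₁ + u₂))) ^ 2 * Real.log u₂ ^ 1) +
      (∫ η in Set.Ioc (0 : ℝ) 1, (η * (∫ u in Set.Ioi (0 : ℝ), Real.log u ^ 2 * Real.log (η / u) ^ 1 *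
            (Real.exp (-(u + η / u)) / (1 - Real.exp (-(u + η / u))) ^ 2) / u) -
          ∫ v in Set.Ioc (0 : ℝ) 1, ((-(Real.log (1 / η) / 2) + Real.log v) ^ 2 * (-(Real.log (1 / η) / 2) - Real.log v) ^ 1 +
              (-(Real.log (1 / η) / 2) - Real.log v) ^ 2 * (-(Real.log (1 / η) / 2) + Real.log v) ^ 1) *
            (v / (1 + v ^ 2) ^ 2)) / η)),
    ((∫ u₁ in Set.Ioi (0 : ℝ), Real.log u₁ ^ 3 * ∫ u₂ in Set.Ioi (1 / u₁),
        Real.exp (-(u₁ + u₂)) / (1 - Real.exp (-(u₁ + u₂))) ^ 2 * Real.log u₂ ^ 0) +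
      (∫ η in Set.Ioc (0 : ℝ) 1, (η * (∫ u in Set.Ioi (0 : ℝ), Real.log u ^ 3 * Real.log (η / u) ^ 0 *
            (Real.exp (-(u + η / u)) / (1 - Real.exp (-(u + η / u))) ^ 2) / u) -
          ∫ v in Set.Ioc (0 : ℝ) 1, ((-(Real.log (1 / η) / 2) + Real.log v) ^ 3 * (-(Real.log (1 / η) / 2) - Real.log v) ^ 0 +
              (-(Real.log (1 / η) / 2) - Real.log v) ^ 3 * (-(Real.log (1 / η) / 2) + Real.log v) ^ 0) *
            (v / (1 + v ^ 2) ^ 2)) / η)),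
    ((∫ u₁ in Set.Ioi (0 : ℝ), Real.log u₁ ^ 0 * ∫ u₂ in Set.Ioi (1 / u₁),
        Real.exp (-(u₁ + u₂)) / (1 - Real.exp (-(u₁ + u₂))) ^ 2 * Real.log u₂ ^ 4) +
      (∫ η in Set.Ioc (0 : ℝ) 1, (η * (∫ u in Set.Ioi (0 : ℝ), Real.log u ^ 0 * Real.log (η / u) ^ 4 *
            (Real.exp (-(u + η / u)) / (1 - Real.exp (-(u + η / u))) ^ 2) / u) -
          ∫ v in Set.Ioc (0 : ℝ) 1, ((-(Real.log (1 / η) / 2) + Real.log v) ^ 0 * (-(Real.log (1 / η) / 2) - Real.log v) ^ 4 +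
              (-(Real.log (1 / η) / 2) - Real.log v) ^ 0 * (-(Real.log (1 / η) / 2) + Real.log v) ^ 4) *
            (v / (1 + v ^ 2) ^ 2)) / η)),
    ((∫ u₁ in Set.Ioi (0 : ℝ), Real.log u₁ ^ 1 * ∫ u₂ in Set.Ioi (1 / u₁),
        Real.exp (-(u₁ + u₂)) / (1 - Real.exp (-(u₁ + u₂))) ^ 2 * Real.log u₂ ^ 3) +
      (∫ η in Set.Ioc (0 : ℝ) 1, (η * (∫ u in Set.Ioi (0 : ℝ), Real.log u ^ 1 * Real.log (η / u) ^ 3 *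
            (Real.exp (-(u + η / u)) / (1 - Real.exp (-(u + η / u))) ^ 2) / u) -
          ∫ v in Set.Ioc (0 : ℝ) 1, ((-(Real.log (1 / η) / 2) + Real.log v) ^ 1 * (-(Real.log (1 / η) / 2) - Real.log v) ^ 3 +
              (-(Real.log (1 / η) / 2) - Real.log v) ^ 1 * (-(Real.log (1 / η) / 2) + Real.log v) ^ 3) *
            (v / (1 + v ^ 2) ^ 2)) / η)),
    ((∫ u₁ in Set.Ioi (0 : ℝ), Real.log u₁ ^ 2 * ∫ u₂ in Set.Ioi (1 / u₁),
        Real.exp (-(u₁ + u₂)) / (1 - Real.exp (-(u₁ + u₂))) ^ 2 * Real.log u₂ ^ 2) +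
      (∫ η in Set.Ioc (0 : ℝ) 1, (η * (∫ u in Set.Ioi (0 : ℝ), Real.log u ^ 2 * Real.log (η / u) ^ 2 *
            (Real.exp (-(u + η / u)) / (1 - Real.exp (-(u + η / u))) ^ 2) / u) -
          ∫ v in Set.Ioc (0 : ℝ) 1, ((-(Real.log (1 / η) / 2) + Real.log v) ^ 2 * (-(Real.log (1 / η) / 2) - Real.log v) ^ 2 +
              (-(Real.log (1 / η) / 2) - Real.log v) ^ 2 * (-(Real.log (1 / η) / 2) + Real.log v) ^ 2) *
            (v / (1 + v ^ 2) ^ 2)) / η)),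
    ((∫ u₁ in Set.Ioi (0 : ℝ), Real.log u₁ ^ 3 * ∫ u₂ in Set.Ioi (1 / u₁),
        Real.exp (-(u₁ + u₂)) / (1 - Real.exp (-(u₁ + u₂))) ^ 2 * Real.log u₂ ^ 1) +
      (∫ η in Set.Ioc (0 : ℝ) 1, (η * (∫ u in Set.Ioi (0 : ℝ), Real.log u ^ 3 * Real.log (η / u) ^ 1 *
            (Real.exp (-(u + η / u)) / (1 - Real.exp (-(u + η / u))) ^ 2) / u) -
          ∫ v in Set.Ioc (0 : ℝ) 1, ((-(Real.log (1 / η) / 2) + Real.log v) ^ 3 * (-(Real.log (1 / η) / 2) - Real.log v) ^ 1 +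
              (-(Real.log (1 / η) / 2) - Real.log v) ^ 3 * (-(Real.log (1 / η) / 2) + Real.log v) ^ 1) *
            (v / (1 + v ^ 2) ^ 2)) / η)),
    ((∫ u₁ in Set.Ioi (0 : ℝ), Real.log u₁ ^ 4 * ∫ u₂ in Set.Ioi (1 / u₁),
        Real.exp (-(u₁ + u₂)) / (1 - Real.exp (-(u₁ + u₂))) ^ 2 * Real.log u₂ ^ 0) +
      (∫ η in Set.Ioc (0 : ℝ) 1, (η * (∫ u in Set.Ioi (0 : ℝ), Real.log u ^ 4 * Real.log (η / u) ^ 0 *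
            (Real.exp (-(u + η / u)) / (1 - Real.exp (-(u + η / u))) ^ 2) / u) -
          ∫ v in Set.Ioc (0 : ℝ) 1, ((-(Real.log (1 / η) / 2) + Real.log v) ^ 4 * (-(Real.log (1 / η) / 2) - Real.log v) ^ 0 +
              (-(Real.log (1 / η) / 2) - Real.log v) ^ 4 * (-(Real.log (1 / η) / 2) + Real.log v) ^ 0) *
            (v / (1 + v ^ 2) ^ 2)) / η)),
    C₀, hC₀0, ?_, ?_⟩
  · intro R hRR a₁ a₂ Y α B η K₁ i j hY hα hi hj hB hη hY₁
    have hY0 : 0 < Y := by linarith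
    have hη0 : 0 ≤ η := (abs_nonneg _).trans (hη K₁ le_rfl)
    have hLY : 0 ≤ Real.log Y := Real.log_nonneg hY
    have hx : (1 : ℝ) ≤ 1 + |Real.log (2 * α * Y ^ 2)| := by linarith [abs_nonneg (Real.log (2 * α * Y ^ 2))]
    have hSj : 0 ≤ ∑ k ∈ Icc 1 ⌊Y⌋₊, |a₂ k| * ellp Y k ^ j :=
      Finset.sum_nonneg fun k _ ↦ mul_nonneg (abs_nonneg _) (pow_nonneg (ellp_nonneg Y k) j)
    have hSi : 0 ≤ ∑ k ∈ Icc 1 ⌊Y⌋₊, |a₁ k| * ellp Y k ^ i :=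
      Finset.sum_nonneg fun k _ ↦ mul_nonneg (abs_nonneg _) (pow_nonneg (ellp_nonneg Y k) i)
    have hB0 : 0 ≤ B := (abs_nonneg _).trans (hB 0 (Nat.zero_le _))
    have hsq : 0 ≤ Real.sqrt (2 * α * K₁ * Y) := Real.sqrt_nonneg _
    have hfirst : ∀ {C : ℝ}, C ≤ C₀ →
        (∑ k ∈ Icc 1 ⌊Y⌋₊, |a₁ k| * ellp Y k ^ i) * (B * (Real.log Y ^ j * (3 * C * Real.sqrt (2 * α * K₁ * Y)))) ≤
        (∑ k ∈ Icc 1 ⌊Y⌋₊, |a₁ k| * ellp Y k ^ i) * (B * (Real.log Y ^ j * (3 * C₀ * Real.sqrt (2 * α * K₁ * Y)))) := by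
      intro C hC
      have hLj : 0 ≤ Real.log Y ^ j := pow_nonneg hLY j
      gcongr
    have hsecond : ∀ {C : ℝ} {N : ℕ}, 0 ≤ C → C ≤ C₀ →
        (∑ k ∈ Icc 1 ⌊Y⌋₊, |a₂ k| * ellp Y k ^ j) * ((2 * η) * (Real.log Y ^ i *
            (3 * (C + C * (1 + |Real.log (2 * α * Y ^ 2)|) ^ N) + 2 * C +
              C * (1 + |Real.log (2 * α * Y ^ 2)|) ^ N * (1 + |Real.log (2 * α * Y ^ 2)|)))) ≤
        (∑ k ∈ Icc 1 ⌊Y⌋₊, |a₂ k| * ellp Y k ^ j) * ((2 * η) * (Real.log Y ^ i *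
            (3 * (C₀ + C₀ * (1 + |Real.log (2 * α * Y ^ 2)|) ^ N) + 2 * C₀ +
              C₀ * (1 + |Real.log (2 * α * Y ^ 2)|) ^ N * (1 + |Real.log (2 * α * Y ^ 2)|)))) := by
      intro C N hC hCC
      have hLi : 0 ≤ Real.log Y ^ i := pow_nonneg hLY i
      have hxN : 0 ≤ (1 + |Real.log (2 * α * Y ^ 2)|) ^ N := pow_nonneg (by positivity) N
      gcongr
    rcases hRR with rfl | rfl | rfl | rfl | rfl | rfl | rfl | rfl | rfl
    · have h := h₀₃ a₁ a₂ Y α B η K₁ i j hY hα hi hj hB hη hY₁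
      have h' := le_trans h (add_le_add (hfirst e₀₃) (hsecond hC₀₃ e₀₃))
      have h'' := weaken_second_term10 hSj hη0 hLY hC₀0 hx (by norm_num : 0 + 3 + 1 ≤ 9) h'
      refine le_trans (le_of_eq ?_) h''
      congr 1
      refine Finset.sum_congr rfl fun k₁ _ ↦ Finset.sum_congr rfl fun k₂ _ ↦ ?_
      simp only [Finset.sum_range_succ, Finset.sum_range_zero, zero_add, add_zero, Nat.choose_self, Nat.choose_zero_right, Nat.choose_one_right, hc32, Nat.cast_one, Nat.cast_ofNat, Nat.sub_self, Nat.sub_zero, Nat.reduceSub, Nat.reduceAdd, Nat.cast_zero, Nat.cast_add, pow_zero, pow_one, one_mul, mul_one, integral_model_weight_Ioc]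
      ring
    · have h := h₁₂ a₁ a₂ Y α B η K₁ i j hY hα hi hj hB hη hY₁
      have h' := le_trans h (add_le_add (hfirst e₁₂) (hsecond hC₁₂ e₁₂))
      have h'' := weaken_second_term10 hSj hη0 hLY hC₀0 hx (by norm_num : 1 + 2 + 1 ≤ 9) h'
      refine le_trans (le_of_eq ?_) h''
      congr 1
      refine Finset.sum_congr rfl fun k₁ _ ↦ Finset.sum_congr rfl fun k₂ _ ↦ ?_
      simp only [Finset.sum_range_succ, Finset.sum_range_zero, zero_add, add_zero, Nat.choose_self, Nat.choose_zero_right, Nat.choose_one_right, Nat.cast_one, Nat.cast_ofNat, Nat.sub_self, Nat.sub_zero, Nat.reduceSub, Nat.reduceAdd, Nat.cast_zero, Nat.cast_add, pow_zero, pow_one, one_mul, mul_one, integral_model_weight_Ioc]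
      ring
    · have h := h₂₁ a₁ a₂ Y α B η K₁ i j hY hα hi hj hB hη hY₁
      have h' := le_trans h (add_le_add (hfirst e₂₁) (hsecond hC₂₁ e₂₁))
      have h'' := weaken_second_term10 hSj hη0 hLY hC₀0 hx (by norm_num : 2 + 1 + 1 ≤ 9) h'
      refine le_trans (le_of_eq ?_) h''
      congr 1
      refine Finset.sum_congr rfl fun k₁ _ ↦ Finset.sum_congr rfl fun k₂ _ ↦ ?_
      simp only [Finset.sum_range_succ, Finset.sum_range_zero, zero_add, add_zero, Nat.choose_self, Nat.choose_zero_right, Nat.choose_one_right, Nat.cast_one, Nat.cast_ofNat, Nat.sub_self, Nat.sub_zero, Nat.reduceSub, Nat.reduceAdd, Nat.cast_zero, Nat.cast_add, pow_zero, pow_one, one_mul, mul_one, integral_model_weight_Ioc]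
      ring
    · have h := h₃₀ a₁ a₂ Y α B η K₁ i j hY hα hi hj hB hη hY₁
      have h' := le_trans h (add_le_add (hfirst e₃₀) (hsecond hC₃₀ e₃₀))
      have h'' := weaken_second_term10 hSj hη0 hLY hC₀0 hx (by norm_num : 3 + 0 + 1 ≤ 9) h'
      refine le_trans (le_of_eq ?_) h''
      congr 1
      refine Finset.sum_congr rfl fun k₁ _ ↦ Finset.sum_congr rfl fun k₂ _ ↦ ?_
      simp only [Finset.sum_range_succ, Finset.sum_range_zero, zero_add, add_zero, Nat.choose_self, Nat.choose_zero_right, Nat.choose_one_right, hc32, Nat.cast_one, Nat.cast_ofNat, Nat.sub_self, Nat.sub_zero, Nat.reduceSub, Nat.reduceAdd, Nat.cast_zero, Nat.cast_add, pow_zero, pow_one, one_mul, mul_one, integral_model_weight_Ioc]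
      ring
    · have h := h₀₄ a₁ a₂ Y α B η K₁ i j hY hα hi hj hB hη hY₁
      have h' := le_trans h (add_le_add (hfirst e₀₄) (hsecond hC₀₄ e₀₄))
      have h'' := weaken_second_term10 hSj hη0 hLY hC₀0 hx (by norm_num : 0 + 4 + 1 ≤ 9) h'
      refine le_trans (le_of_eq ?_) h''
      congr 1
      refine Finset.sum_congr rfl fun k₁ _ ↦ Finset.sum_congr rfl fun k₂ _ ↦ ?_
      simp only [Finset.sum_range_succ, Finset.sum_range_zero, zero_add, add_zero, Nat.choose_self, Nat.choose_zero_right, Nat.choose_one_right, hc42, hc43, Nat.cast_one, Nat.cast_ofNat, Nat.sub_self, Nat.sub_zero, Nat.reduceSub, Nat.reduceAdd, Nat.cast_zero, Nat.cast_add, pow_zero, pow_one, one_mul, mul_one, integral_model_weight_Ioc]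
      ring
    · have h := h₁₃ a₁ a₂ Y α B η K₁ i j hY hα hi hj hB hη hY₁
      have h' := le_trans h (add_le_add (hfirst e₁₃) (hsecond hC₁₃ e₁₃))
      have h'' := weaken_second_term10 hSj hη0 hLY hC₀0 hx (by norm_num : 1 + 3 + 1 ≤ 9) h'
      refine le_trans (le_of_eq ?_) h''
      congr 1
      refine Finset.sum_congr rfl fun k₁ _ ↦ Finset.sum_congr rfl fun k₂ _ ↦ ?_
      simp only [Finset.sum_range_succ, Finset.sum_range_zero, zero_add, add_zero, Nat.choose_self, Nat.choose_zero_right, Nat.choose_one_right, hc32, Nat.cast_one, Nat.cast_ofNat, Nat.sub_self, Nat.sub_zero, Nat.reduceSub, Nat.reduceAdd, Nat.cast_zero, Nat.cast_add, pow_zero, pow_one, one_mul, mul_one, integral_model_weight_Ioc]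
      ring
    · have h := h₂₂ a₁ a₂ Y α B η K₁ i j hY hα hi hj hB hη hY₁
      have h' := le_trans h (add_le_add (hfirst e₂₂) (hsecond hC₂₂ e₂₂))
      have h'' := weaken_second_term10 hSj hη0 hLY hC₀0 hx (by norm_num : 2 + 2 + 1 ≤ 9) h'
      refine le_trans (le_of_eq ?_) h''
      congr 1
      refine Finset.sum_congr rfl fun k₁ _ ↦ Finset.sum_congr rfl fun k₂ _ ↦ ?_
      simp only [Finset.sum_range_succ, Finset.sum_range_zero, zero_add, add_zero, Nat.choose_self, Nat.choose_zero_right, Nat.choose_one_right, Nat.cast_one, Nat.cast_ofNat, Nat.sub_self, Nat.sub_zero, Nat.reduceSub, Nat.reduceAdd, Nat.cast_zero, Nat.cast_add, pow_zero, pow_one, one_mul, mul_one, integral_model_weight_Ioc]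
      ring
    · have h := h₃₁ a₁ a₂ Y α B η K₁ i j hY hα hi hj hB hη hY₁
      have h' := le_trans h (add_le_add (hfirst e₃₁) (hsecond hC₃₁ e₃₁))
      have h'' := weaken_second_term10 hSj hη0 hLY hC₀0 hx (by norm_num : 3 + 1 + 1 ≤ 9) h'
      refine le_trans (le_of_eq ?_) h''
      congr 1
      refine Finset.sum_congr rfl fun k₁ _ ↦ Finset.sum_congr rfl fun k₂ _ ↦ ?_
      simp only [Finset.sum_range_succ, Finset.sum_range_zero, zero_add, add_zero, Nat.choose_self, Nat.choose_zero_right, Nat.choose_one_right, hc32, Nat.cast_one, Nat.cast_ofNat, Nat.sub_self, Nat.sub_zero, Nat.reduceSub, Nat.reduceAdd, Nat.cast_zero, Nat.cast_add, pow_zero, pow_one, one_mul, mul_one, integral_model_weight_Ioc]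
      ring
    · have h := h₄₀ a₁ a₂ Y α B η K₁ i j hY hα hi hj hB hη hY₁
      have h' := le_trans h (add_le_add (hfirst e₄₀) (hsecond hC₄₀ e₄₀))
      have h'' := weaken_second_term10 hSj hη0 hLY hC₀0 hx (by norm_num : 4 + 0 + 1 ≤ 9) h'
      refine le_trans (le_of_eq ?_) h''
      congr 1
      refine Finset.sum_congr rfl fun k₁ _ ↦ Finset.sum_congr rfl fun k₂ _ ↦ ?_
      simp only [Finset.sum_range_succ, Finset.sum_range_zero, zero_add, add_zero, Nat.choose_self, Nat.choose_zero_right, Nat.choose_one_right, hc42, hc43, Nat.cast_one, Nat.cast_ofNat, Nat.sub_self, Nat.sub_zero, Nat.reduceSub, Nat.reduceAdd, Nat.cast_zero, Nat.cast_add, pow_zero, pow_one, one_mul, mul_one, integral_model_weight_Ioc]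
      ring
  · intro R hRR
    rcases hRR with rfl | rfl | rfl | rfl | rfl | rfl | rfl | rfl | rfl
    · refine ⟨fun y hy0 hy1 ↦ ?_, fun y hy ↦ ?_⟩
      · refine le_trans (le_of_eq ?_) ((hs₀₃ y hy0 hy1).trans (mul_le_mul_of_nonneg_right e₀₃ (Real.sqrt_nonneg y)))
        congr 1
        simp only [Finset.sum_range_succ, Finset.sum_range_zero, zero_add, add_zero, Nat.choose_self, Nat.choose_zero_right, Nat.choose_one_right, hc32, Nat.cast_one, Nat.cast_ofNat, Nat.sub_self, Nat.sub_zero, Nat.reduceSub, Nat.reduceAdd, Nat.cast_zero, Nat.cast_add, pow_zero, pow_one, one_mul, mul_one, integral_model_weight_Ioc]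
        ring
      · have hl1 : 1 ≤ 1 + Real.log y := by linarith [Real.log_nonneg hy]
        have hpw : (1 + Real.log y) ^ (0 + 3 + 1) ≤ (1 + Real.log y) ^ 5 := pow_le_pow_right₀ hl1 (by norm_num)
        refine le_trans (le_of_eq ?_) (((ht₀₃ y hy).trans (mul_le_mul_of_nonneg_right e₀₃ (pow_nonneg (by linarith) _))).trans
          (mul_le_mul_of_nonneg_left hpw hC₀0))
        congr 1
        simp only [Finset.sum_range_succ, Finset.sum_range_zero, zero_add, add_zero, Nat.choose_self, Nat.choose_zero_right, Nat.choose_one_right, hc32, Nat.cast_one, Nat.cast_ofNat, Nat.sub_self, Nat.sub_zero, Nat.reduceSub, Nat.reduceAdd, Nat.cast_zero, Nat.cast_add, pow_zero, pow_one, one_mul, mul_one, integral_model_weight_Ioc]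
        ring
    · refine ⟨fun y hy0 hy1 ↦ ?_, fun y hy ↦ ?_⟩
      · refine le_trans (le_of_eq ?_) ((hs₁₂ y hy0 hy1).trans (mul_le_mul_of_nonneg_right e₁₂ (Real.sqrt_nonneg y)))
        congr 1
        simp only [Finset.sum_range_succ, Finset.sum_range_zero, zero_add, add_zero, Nat.choose_self, Nat.choose_zero_right, Nat.choose_one_right, Nat.cast_one, Nat.cast_ofNat, Nat.sub_self, Nat.sub_zero, Nat.reduceSub, Nat.reduceAdd, Nat.cast_zero, Nat.cast_add, pow_zero, pow_one, one_mul, mul_one, integral_model_weight_Ioc]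
        ring
      · have hl1 : 1 ≤ 1 + Real.log y := by linarith [Real.log_nonneg hy]
        have hpw : (1 + Real.log y) ^ (1 + 2 + 1) ≤ (1 + Real.log y) ^ 5 := pow_le_pow_right₀ hl1 (by norm_num)
        refine le_trans (le_of_eq ?_) (((ht₁₂ y hy).trans (mul_le_mul_of_nonneg_right e₁₂ (pow_nonneg (by linarith) _))).trans
          (mul_le_mul_of_nonneg_left hpw hC₀0))
        congr 1
        simp only [Finset.sum_range_succ, Finset.sum_range_zero, zero_add, add_zero, Nat.choose_self, Nat.choose_zero_right, Nat.choose_one_right, Nat.cast_one, Nat.cast_ofNat, Nat.sub_self, Nat.sub_zero, Nat.reduceSub, Nat.reduceAdd, Nat.cast_zero, Nat.cast_add, pow_zero, pow_one, one_mul, mul_one, integral_model_weight_Ioc]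
        ring
    · refine ⟨fun y hy0 hy1 ↦ ?_, fun y hy ↦ ?_⟩
      · refine le_trans (le_of_eq ?_) ((hs₂₁ y hy0 hy1).trans (mul_le_mul_of_nonneg_right e₂₁ (Real.sqrt_nonneg y)))
        congr 1
        simp only [Finset.sum_range_succ, Finset.sum_range_zero, zero_add, add_zero, Nat.choose_self, Nat.choose_zero_right, Nat.choose_one_right, Nat.cast_one, Nat.cast_ofNat, Nat.sub_self, Nat.sub_zero, Nat.reduceSub, Nat.reduceAdd, Nat.cast_zero, Nat.cast_add, pow_zero, pow_one, one_mul, mul_one, integral_model_weight_Ioc]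
        ring
      · have hl1 : 1 ≤ 1 + Real.log y := by linarith [Real.log_nonneg hy]
        have hpw : (1 + Real.log y) ^ (2 + 1 + 1) ≤ (1 + Real.log y) ^ 5 := pow_le_pow_right₀ hl1 (by norm_num)
        refine le_trans (le_of_eq ?_) (((ht₂₁ y hy).trans (mul_le_mul_of_nonneg_right e₂₁ (pow_nonneg (by linarith) _))).trans
          (mul_le_mul_of_nonneg_left hpw hC₀0))
        congr 1
        simp only [Finset.sum_range_succ, Finset.sum_range_zero, zero_add, add_zero, Nat.choose_self, Nat.choose_zero_right, Nat.choose_one_right, Nat.cast_one, Nat.cast_ofNat, Nat.sub_self, Nat.sub_zero, Nat.reduceSub, Nat.reduceAdd, Nat.cast_zero, Nat.cast_add, pow_zero, pow_one, one_mul, mul_one, integral_model_weight_Ioc]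
        ring
    · refine ⟨fun y hy0 hy1 ↦ ?_, fun y hy ↦ ?_⟩
      · refine le_trans (le_of_eq ?_) ((hs₃₀ y hy0 hy1).trans (mul_le_mul_of_nonneg_right e₃₀ (Real.sqrt_nonneg y)))
        congr 1
        simp only [Finset.sum_range_succ, Finset.sum_range_zero, zero_add, add_zero, Nat.choose_self, Nat.choose_zero_right, Nat.choose_one_right, hc32, Nat.cast_one, Nat.cast_ofNat, Nat.sub_self, Nat.sub_zero, Nat.reduceSub, Nat.reduceAdd, Nat.cast_zero, Nat.cast_add, pow_zero, pow_one, one_mul, mul_one, integral_model_weight_Ioc]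
        ring
      · have hl1 : 1 ≤ 1 + Real.log y := by linarith [Real.log_nonneg hy]
        have hpw : (1 + Real.log y) ^ (3 + 0 + 1) ≤ (1 + Real.log y) ^ 5 := pow_le_pow_right₀ hl1 (by norm_num)
        refine le_trans (le_of_eq ?_) (((ht₃₀ y hy).trans (mul_le_mul_of_nonneg_right e₃₀ (pow_nonneg (by linarith) _))).trans
          (mul_le_mul_of_nonneg_left hpw hC₀0))
        congr 1
        simp only [Finset.sum_range_succ, Finset.sum_range_zero, zero_add, add_zero, Nat.choose_self, Nat.choose_zero_right, Nat.choose_one_right, hc32, Nat.cast_one, Nat.cast_ofNat, Nat.sub_self, Nat.sub_zero, Nat.reduceSub, Nat.reduceAdd, Nat.cast_zero, Nat.cast_add, pow_zero, pow_one, one_mul, mul_one, integral_model_weight_Ioc]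
        ring
    · refine ⟨fun y hy0 hy1 ↦ ?_, fun y hy ↦ ?_⟩
      · refine le_trans (le_of_eq ?_) ((hs₀₄ y hy0 hy1).trans (mul_le_mul_of_nonneg_right e₀₄ (Real.sqrt_nonneg y)))
        congr 1
        simp only [Finset.sum_range_succ, Finset.sum_range_zero, zero_add, add_zero, Nat.choose_self, Nat.choose_zero_right, Nat.choose_one_right, hc42, hc43, Nat.cast_one, Nat.cast_ofNat, Nat.sub_self, Nat.sub_zero, Nat.reduceSub, Nat.reduceAdd, Nat.cast_zero, Nat.cast_add, pow_zero, pow_one, one_mul, mul_one, integral_model_weight_Ioc]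
        ring
      · have hl1 : 1 ≤ 1 + Real.log y := by linarith [Real.log_nonneg hy]
        have hpw : (1 + Real.log y) ^ (0 + 4 + 1) ≤ (1 + Real.log y) ^ 5 := pow_le_pow_right₀ hl1 (by norm_num)
        refine le_trans (le_of_eq ?_) (((ht₀₄ y hy).trans (mul_le_mul_of_nonneg_right e₀₄ (pow_nonneg (by linarith) _))).trans
          (mul_le_mul_of_nonneg_left hpw hC₀0))
        congr 1
        simp only [Finset.sum_range_succ, Finset.sum_range_zero, zero_add, add_zero, Nat.choose_self, Nat.choose_zero_right, Nat.choose_one_right, hc42, hc43, Nat.cast_one, Nat.cast_ofNat, Nat.sub_self, Nat.sub_zero, Nat.reduceSub, Nat.reduceAdd, Nat.cast_zero, Nat.cast_add, pow_zero, pow_one, one_mul, mul_one, integral_model_weight_Ioc]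
        ring
    · refine ⟨fun y hy0 hy1 ↦ ?_, fun y hy ↦ ?_⟩
      · refine le_trans (le_of_eq ?_) ((hs₁₃ y hy0 hy1).trans (mul_le_mul_of_nonneg_right e₁₃ (Real.sqrt_nonneg y)))
        congr 1
        simp only [Finset.sum_range_succ, Finset.sum_range_zero, zero_add, add_zero, Nat.choose_self, Nat.choose_zero_right, Nat.choose_one_right, hc32, Nat.cast_one, Nat.cast_ofNat, Nat.sub_self, Nat.sub_zero, Nat.reduceSub, Nat.reduceAdd, Nat.cast_zero, Nat.cast_add, pow_zero, pow_one, one_mul, mul_one, integral_model_weight_Ioc]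
        ring
      · have hl1 : 1 ≤ 1 + Real.log y := by linarith [Real.log_nonneg hy]
        have hpw : (1 + Real.log y) ^ (1 + 3 + 1) ≤ (1 + Real.log y) ^ 5 := pow_le_pow_right₀ hl1 (by norm_num)
        refine le_trans (le_of_eq ?_) (((ht₁₃ y hy).trans (mul_le_mul_of_nonneg_right e₁₃ (pow_nonneg (by linarith) _))).trans
          (mul_le_mul_of_nonneg_left hpw hC₀0))
        congr 1
        simp only [Finset.sum_range_succ, Finset.sum_range_zero, zero_add, add_zero, Nat.choose_self, Nat.choose_zero_right, Nat.choose_one_right, hc32, Nat.cast_one, Nat.cast_ofNat, Nat.sub_self, Nat.sub_zero, Nat.reduceSub, Nat.reduceAdd, Nat.cast_zero, Nat.cast_add, pow_zero, pow_one, one_mul, mul_one, integral_model_weight_Ioc]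
        ring
    · refine ⟨fun y hy0 hy1 ↦ ?_, fun y hy ↦ ?_⟩
      · refine le_trans (le_of_eq ?_) ((hs₂₂ y hy0 hy1).trans (mul_le_mul_of_nonneg_right e₂₂ (Real.sqrt_nonneg y)))
        congr 1
        simp only [Finset.sum_range_succ, Finset.sum_range_zero, zero_add, add_zero, Nat.choose_self, Nat.choose_zero_right, Nat.choose_one_right, Nat.cast_one, Nat.cast_ofNat, Nat.sub_self, Nat.sub_zero, Nat.reduceSub, Nat.reduceAdd, Nat.cast_zero, Nat.cast_add, pow_zero, pow_one, one_mul, mul_one, integral_model_weight_Ioc]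
        ring
      · have hl1 : 1 ≤ 1 + Real.log y := by linarith [Real.log_nonneg hy]
        have hpw : (1 + Real.log y) ^ (2 + 2 + 1) ≤ (1 + Real.log y) ^ 5 := pow_le_pow_right₀ hl1 (by norm_num)
        refine le_trans (le_of_eq ?_) (((ht₂₂ y hy).trans (mul_le_mul_of_nonneg_right e₂₂ (pow_nonneg (by linarith) _))).trans
          (mul_le_mul_of_nonneg_left hpw hC₀0))
        congr 1
        simp only [Finset.sum_range_succ, Finset.sum_range_zero, zero_add, add_zero, Nat.choose_self, Nat.choose_zero_right, Nat.choose_one_right, Nat.cast_one, Nat.cast_ofNat, Nat.sub_self, Nat.sub_zero, Nat.reduceSub, Nat.reduceAdd, Nat.cast_zero, Nat.cast_add, pow_zero, pow_one, one_mul, mul_one, integral_model_weight_Ioc]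
        ring
    · refine ⟨fun y hy0 hy1 ↦ ?_, fun y hy ↦ ?_⟩
      · refine le_trans (le_of_eq ?_) ((hs₃₁ y hy0 hy1).trans (mul_le_mul_of_nonneg_right e₃₁ (Real.sqrt_nonneg y)))
        congr 1
        simp only [Finset.sum_range_succ, Finset.sum_range_zero, zero_add, add_zero, Nat.choose_self, Nat.choose_zero_right, Nat.choose_one_right, hc32, Nat.cast_one, Nat.cast_ofNat, Nat.sub_self, Nat.sub_zero, Nat.reduceSub, Nat.reduceAdd, Nat.cast_zero, Nat.cast_add, pow_zero, pow_one, one_mul, mul_one, integral_model_weight_Ioc]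
        ring
      · have hl1 : 1 ≤ 1 + Real.log y := by linarith [Real.log_nonneg hy]
        have hpw : (1 + Real.log y) ^ (3 + 1 + 1) ≤ (1 + Real.log y) ^ 5 := pow_le_pow_right₀ hl1 (by norm_num)
        refine le_trans (le_of_eq ?_) (((ht₃₁ y hy).trans (mul_le_mul_of_nonneg_right e₃₁ (pow_nonneg (by linarith) _))).trans
          (mul_le_mul_of_nonneg_left hpw hC₀0))
        congr 1
        simp only [Finset.sum_range_succ, Finset.sum_range_zero, zero_add, add_zero, Nat.choose_self, Nat.choose_zero_right, Nat.choose_one_right, hc32, Nat.cast_one, Nat.cast_ofNat, Nat.sub_self, Nat.sub_zero, Nat.reduceSub, Nat.reduceAdd, Nat.cast_zero, Nat.cast_add, pow_zero, pow_one, one_mul, mul_one, integral_model_weight_Ioc]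
        ring
    · refine ⟨fun y hy0 hy1 ↦ ?_, fun y hy ↦ ?_⟩
      · refine le_trans (le_of_eq ?_) ((hs₄₀ y hy0 hy1).trans (mul_le_mul_of_nonneg_right e₄₀ (Real.sqrt_nonneg y)))
        congr 1
        simp only [Finset.sum_range_succ, Finset.sum_range_zero, zero_add, add_zero, Nat.choose_self, Nat.choose_zero_right, Nat.choose_one_right, hc42, hc43, Nat.cast_one, Nat.cast_ofNat, Nat.sub_self, Nat.sub_zero, Nat.reduceSub, Nat.reduceAdd, Nat.cast_zero, Nat.cast_add, pow_zero, pow_one, one_mul, mul_one, integral_model_weight_Ioc]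
        ring
      · have hl1 : 1 ≤ 1 + Real.log y := by linarith [Real.log_nonneg hy]
        have hpw : (1 + Real.log y) ^ (4 + 0 + 1) ≤ (1 + Real.log y) ^ 5 := pow_le_pow_right₀ hl1 (by norm_num)
        refine le_trans (le_of_eq ?_) (((ht₄₀ y hy).trans (mul_le_mul_of_nonneg_right e₄₀ (pow_nonneg (by linarith) _))).trans
          (mul_le_mul_of_nonneg_left hpw hC₀0))
        congr 1
        simp only [Finset.sum_range_succ, Finset.sum_range_zero, zero_add, add_zero, Nat.choose_self, Nat.choose_zero_right, Nat.choose_one_right, hc42, hc43, Nat.cast_one, Nat.cast_ofNat, Nat.sub_self, Nat.sub_zero, Nat.reduceSub, Nat.reduceAdd, Nat.cast_zero, Nat.cast_add, pow_zero, pow_one, one_mul, mul_one, integral_model_weight_Ioc]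
        ring

end Summit.Parity.GeneralizedHardyLittlewood.Theorems.MomentsBeyondDiagonal.DiagCorner

end
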